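import Summits.HodgeConjecture.HodgeCM.Model.LiuDictionaryPin
import Summits.HodgeConjecture.HodgeCM.CM.CommonReflexSpan_1
import Literature.AlgebraicGeometry.HodgeTheory.HodgeTypeExteriorProduct
import HarnessLib

/-!
# Δ2 bridge — the Hodge type of the dictionary's CM classes (`cmClasses`), kernel (ORIENTATION-MEMO §4, test T1)

Theorems only (kernel lane), outside the port manifest.  For a real-carrier dictionary
`T : HodgeCM.Model.LiuDictionary hHD hI h₁ h₃ V` ([Liu21] §4.2 at the model, `HodgeCM/Model/LiuDictionary.lean`) the
generator set of the combined reading r8 at level `K` and character `μ` is, BY COMPREHENSION,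
`T.cmClasses K μ = ⋃ d, ⋃ (_ : T.adm μ d), range (geomClass K d)` with `geomClass K d f = (f^* ⊗ ℂ) d.α` for a
`ℂ`-morphism `f : P_K ⟶ d.A.X` into the abelian variety of an admissible CM record `d : LiuCMSide` (binder-2's
context-free records `(K', Φ', M, k, A, ιA, θA, ΦA, hΦA, isRealisation, τ, α, α_mem)`).

WHAT IS PROVED (no hypothesis beyond the dictionary's own data; `hHD`/`hI` enter only through the TYPE of `T`):
* `isOfHodgeType_one_zero_α_of_tau_mem` / `isOfHodgeType_zero_one_α_of_tau_notMem` — the record's class `d.α`, read in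
  `H¹(d.A(ℂ); ℂ)` through the comparison `β : ℂ ⊗_ℚ H¹(–; ℚ) ≃ H¹(–; ℂ)`, is of Hodge type `(1,0)` if `d.τ ∈ d.ΦA` and of type
  `(0,1)` if `d.τ ∉ d.ΦA` (`IsCMTypeRealisation` clauses + `map_eigenline_complexify`);
* `isOfHodgeType_geomClass_of_tau_mem` / `…_of_tau_notMem` — so is every geometric class `geomClass K d f = f^* d.α` on the
  Picard modular surface `P_K` (pull-backs along morphisms of smooth projective varieties preserve Hodge types,
  `IsOfHodgeType.map_of_isSmoothProjective`, hypothesis-free in the tree);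
* `isOfHodgeType_one_zero_of_mem_cmClasses` — hence, for any dictionary whose admissibility clause at `μ` forces `d.τ ∈ d.ΦA`,
  EVERY element of `T.cmClasses K μ` is a `(1,0)`-class on `P_K`; twin `isOfHodgeType_zero_one_of_mem_cmClasses` for `d.τ ∉ d.ΦA`;
* `isOfHodgeType_one_zero_of_mem_span_cmClasses` — and so is every element of their `ℂ`-span (the target of r8's «`⊆ span`»).

USE (ORIENTATION-MEMO v1.1 §3.1 (C), DECISION #14 §2(c)): at the literal pin `liuDictionaryPin … V I line` the admissibility
clause is `adm i d = d.IsReflexOfTypeG ι₁ (typeOfLine (line i))` and `PhiMu i = (ι₁ ∈ (typeOfLine (line i)).1)`; with the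
orientation lemma `d.IsReflexOfType ι₁ Φ → ι₁ ∈ Φ.1 → d.τ ∈ d.ΦA.1` (own-crow, `CorCM/D2Bridge/OrientationReflexConj.lean`,
Shimura §8.3 Prop. 28) the hypothesis `hadm` of `isOfHodgeType_one_zero_of_mem_cmClasses` is met at every `PhiMu` line over a
Galois CM field `L`: the classes r8 asks the `μ_i`-block to restrict into are ALL of type `(1,0)`.  Nothing here decides the
fork (c-A)/(c-S) of the memo; HC_CM is NOT proved by this file; no pointer, label or count moves.

References: C. Voisin, *Hodge Theory and Complex Algebraic Geometry I* (CUP 2002) §7.1.1, §7.3.2; G. Shimura, *Abelian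
Varieties with Complex Multiplication and Modular Functions* (PUP 1998) §5.2; Y. Liu, *Camb. J. Math.* 9 (2021) §4.2,
Thm. 4.18 and its proof (the class `α`, TeX l. 2250).
-/

noncomputable section

open scoped TensorProduct
open CategoryTheory Module

namespace Summit.HodgeConjecture.CorCM.D2Bridge

open Literature.AlgebraicGeometry.Motives (SchemeOver IsSmoothProjective CMType AbelianVariety bettiCohomology
  ofRatClassBaseChange ComplexPoints)
open Literature.AlgebraicGeometry.HodgeTheory (complexBetti IsOfHodgeType ofRatClassBaseChangeEquiv
  exists_isReal_hodgeModel hodgePQ_independent_of_hodgeModel)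
open Literature.AlgebraicGeometry.HodgeTheory.BettiUniverse (pull cmAction)
open Literature.AlgebraicGeometry.ComplexMultiplication (IsCMTypeRealisation)
open Literature.NumberTheory.Automorphic.PicardCM
open HodgeCM HodgeCM.Model HodgeCM.Model.LiuDictionary
open HodgeCM.CM.CommonReflex (complexify map_eigenline_complexify)

/-! ## §1 The Hodge type of a CM record's class `d.α` -/

section Record

variable (d : LiuCMSide)

/-- The record's class read in `H¹(d.A(ℂ); ℂ)` lies in the `d.τ`-eigenline of `θA` (transport of `d.α_mem` along
`β : ℂ ⊗_ℚ H¹(A; ℚ) ≃ H¹(A(ℂ); ℂ)`, `map_eigenline_complexify`). [folklore] -/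
theorem ofRatClassBaseChange_α_mem_eigenline :
    ofRatClassBaseChange (ComplexPoints d.A.X) 1 d.α ∈ eigenline d.θA d.τ := by
  have h := map_eigenline_complexify d.isRealisation.1 d.θA d.isRealisation.isInducedOnIntegers d.τ
  rw [← h]
  exact ⟨d.α, d.α_mem, rfl⟩

/-- **A record whose eigencharacter lies IN its CM type carries a `(1,0)`-class**: if `d.τ ∈ d.ΦA` then `β(d.α)` is of Hodge type
`(1,0)` on `d.A` (`IsCMTypeRealisation`, clause `σ ∈ Φ`). [cite: Shimura1998, §5.2 (pp. 36–37)] -/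
theorem isOfHodgeType_one_zero_α_of_tau_mem (hτ : d.τ ∈ d.ΦA.1) :
    IsOfHodgeType (Module.finrank ℚ d.M / 2) d.A.X 1 1 0 (ofRatClassBaseChange (ComplexPoints d.A.X) 1 d.α) :=
  (d.isRealisation.2.2.2 d.τ).2.1 hτ _ (ofRatClassBaseChange_α_mem_eigenline d)

/-- **A record whose eigencharacter lies OUTSIDE its CM type carries a `(0,1)`-class**: if `d.τ ∉ d.ΦA` then `β(d.α)` is of Hodge
type `(0,1)` on `d.A` (`IsCMTypeRealisation`, clause `σ ∉ Φ`). [cite: Shimura1998, §5.2 (pp. 36–37)] -/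
theorem isOfHodgeType_zero_one_α_of_tau_notMem (hτ : d.τ ∉ d.ΦA.1) :
    IsOfHodgeType (Module.finrank ℚ d.M / 2) d.A.X 1 0 1 (ofRatClassBaseChange (ComplexPoints d.A.X) 1 d.α) :=
  (d.isRealisation.2.2.2 d.τ).2.2 hτ _ (ofRatClassBaseChange_α_mem_eigenline d)

/-- **Pull-backs of the record's class keep its Hodge type** (Voisin I §7.3.2, hypothesis-free in the tree): for any smooth
projective `Y` of dimension `m` and any `ℂ`-morphism `f : Y ⟶ d.A.X`, `β((f^* ⊗ ℂ) d.α) = f^* β(d.α)` is of type `(p,q)` whenever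
`β(d.α)` is. [cite: VoisinHodgeI2002, §7.3.2] -/
theorem isOfHodgeType_pull_α {m : ℕ} {Y : SchemeOver ℂ} (hY : IsSmoothProjective m Y) (f : Y ⟶ d.A.X) {p q : ℕ}
    (h : IsOfHodgeType (Module.finrank ℚ d.M / 2) d.A.X 1 p q (ofRatClassBaseChange (ComplexPoints d.A.X) 1 d.α)) :
    IsOfHodgeType m Y 1 p q (ofRatClassBaseChange (ComplexPoints Y) 1 ((pull f 1).baseChange ℂ d.α)) := by
  have hnat : ofRatClassBaseChange (ComplexPoints Y) 1 ((pull f 1).baseChange ℂ d.α) =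
      Literature.AlgebraicGeometry.HodgeTheory.complexBetti.map f 1 (ofRatClassBaseChange (ComplexPoints d.A.X) 1 d.α) :=
    Literature.AlgebraicGeometry.HodgeTheory.HodgeModel.ofRatClassBaseChange_baseChange_map f 1 d.α
  rw [hnat]
  exact h.map_of_isSmoothProjective hY d.isRealisation.1 f

end Record

/-! ## §2 The geometric classes `geomClass K d f` on the Picard modular surface `P_K` -/

section Dictionary

variable {hHD : exists_isReal_hodgeModel} {hI : hodgePQ_independent_of_hodgeModel}
  {h₁ : BallQuotientUniformised} {h₃ : CMAbelianVarietyRealised}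
variable {L : CMField} {ι₁ : (L : Type) →+* ℂ} {V : HermSpace3 L ι₁}

/-- `P_K` is a smooth projective surface (the realisation record of the Picard code). [folklore] -/
theorem isSmoothProjective_pms (K : Level V) :
    IsSmoothProjective 2 (pmsRealisation (ballQuotientUniformisedDatum_of h₁) (pmsCode L ι₁ V K)).X :=
  (pmsRealisation (ballQuotientUniformisedDatum_of h₁) (pmsCode L ι₁ V K)).isSmoothProjective

/-- **`geomClass K d f = f^* d.α` is a `(1,0)`-class on `P_K` when `d.τ ∈ d.ΦA`.** [cite: VoisinHodgeI2002, §7.3.2] -/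
theorem isOfHodgeType_geomClass_of_tau_mem (K : Level V) (d : LiuCMSide) (hτ : d.τ ∈ d.ΦA.1)
    (f : (pmsRealisation (ballQuotientUniformisedDatum_of h₁) (pmsCode L ι₁ V K)).X ⟶ d.A.X) :
    IsOfHodgeType 2 (pmsRealisation (ballQuotientUniformisedDatum_of h₁) (pmsCode L ι₁ V K)).X 1 1 0
      (ofRatClassBaseChange (ComplexPoints (pmsRealisation (ballQuotientUniformisedDatum_of h₁) (pmsCode L ι₁ V K)).X) 1
        (geomClass (hHD := hHD) (hI := hI) (h₁ := h₁) (h₃ := h₃) K d f)) :=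
  isOfHodgeType_pull_α d (isSmoothProjective_pms (h₁ := h₁) K) f (isOfHodgeType_one_zero_α_of_tau_mem d hτ)

/-- **`geomClass K d f = f^* d.α` is a `(0,1)`-class on `P_K` when `d.τ ∉ d.ΦA`.** [cite: VoisinHodgeI2002, §7.3.2] -/
theorem isOfHodgeType_geomClass_of_tau_notMem (K : Level V) (d : LiuCMSide) (hτ : d.τ ∉ d.ΦA.1)
    (f : (pmsRealisation (ballQuotientUniformisedDatum_of h₁) (pmsCode L ι₁ V K)).X ⟶ d.A.X) :
    IsOfHodgeType 2 (pmsRealisation (ballQuotientUniformisedDatum_of h₁) (pmsCode L ι₁ V K)).X 1 0 1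
      (ofRatClassBaseChange (ComplexPoints (pmsRealisation (ballQuotientUniformisedDatum_of h₁) (pmsCode L ι₁ V K)).X) 1
        (geomClass (hHD := hHD) (hI := hI) (h₁ := h₁) (h₃ := h₃) K d f)) :=
  isOfHodgeType_pull_α d (isSmoothProjective_pms (h₁ := h₁) K) f (isOfHodgeType_zero_one_α_of_tau_notMem d hτ)

variable (T : LiuDictionary hHD hI h₁ h₃ V)

/-- **T1 (ORIENTATION-MEMO §4): every CM class of the dictionary at a character whose admissible records have their eigencharacter
IN their CM type is a `(1,0)`-class on `P_K`.** [cite: VoisinHodgeI2002, §7.3.2] [cite: Shimura1998, §5.2 (pp. 36–37)] -/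
theorem isOfHodgeType_one_zero_of_mem_cmClasses (K : Level V) (μ : T.Char)
    (hadm : ∀ d : LiuCMSide, T.adm μ d → d.τ ∈ d.ΦA.1)
    {x : (picardCMUniverse hHD hI h₁ h₃).CohC ((picardCMUniverse hHD hI h₁ h₃).pms L ι₁ V K) 1}
    (hx : x ∈ T.cmClasses K μ) :
    IsOfHodgeType 2 (pmsRealisation (ballQuotientUniformisedDatum_of h₁) (pmsCode L ι₁ V K)).X 1 1 0
      (ofRatClassBaseChange (ComplexPoints (pmsRealisation (ballQuotientUniformisedDatum_of h₁) (pmsCode L ι₁ V K)).X) 1 x) := by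
  simp only [cmClasses, Set.mem_iUnion, Set.mem_range] at hx
  obtain ⟨d, hd, f, rfl⟩ := hx
  exact isOfHodgeType_geomClass_of_tau_mem K d (hadm d hd) f

/-- Twin of T1 for the conjugate reading: if the admissible records at `μ` have their eigencharacter OUTSIDE their CM type, every CM
class of the dictionary at `μ` is a `(0,1)`-class on `P_K`. [cite: VoisinHodgeI2002, §7.3.2] [cite: Shimura1998, §5.2 (pp. 36–37)] -/
theorem isOfHodgeType_zero_one_of_mem_cmClasses (K : Level V) (μ : T.Char)
    (hadm : ∀ d : LiuCMSide, T.adm μ d → d.τ ∉ d.ΦA.1)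
    {x : (picardCMUniverse hHD hI h₁ h₃).CohC ((picardCMUniverse hHD hI h₁ h₃).pms L ι₁ V K) 1}
    (hx : x ∈ T.cmClasses K μ) :
    IsOfHodgeType 2 (pmsRealisation (ballQuotientUniformisedDatum_of h₁) (pmsCode L ι₁ V K)).X 1 0 1
      (ofRatClassBaseChange (ComplexPoints (pmsRealisation (ballQuotientUniformisedDatum_of h₁) (pmsCode L ι₁ V K)).X) 1 x) := by
  simp only [cmClasses, Set.mem_iUnion, Set.mem_range] at hx
  obtain ⟨d, hd, f, rfl⟩ := hx
  exact isOfHodgeType_geomClass_of_tau_notMem K d (hadm d hd) f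


/-! ## §3 The same in the end-state universe's Hodge filtration: `cmClasses K μ ⊆ F¹` resp. `⊆ H^{0,1}` -/

/-- The universe's Hodge structure on `H¹(P_K)` is the Betti-universe one of the realising surface (by construction of
`picardCMUniverse = universeOf …`). [folklore] -/
theorem hodge_pms_eq (K : Level V) :
    (picardCMUniverse hHD hI h₁ h₃).hodge ((picardCMUniverse hHD hI h₁ h₃).pms L ι₁ V K) 1 =
      Literature.AlgebraicGeometry.HodgeTheory.BettiUniverse.hodge hHD (isSmoothProjective_pms (h₁ := h₁) K) 1 := rfl

/-- **T1, filtration form: `T.cmClasses K μ ⊆ F¹ H¹(P_K; ℂ)`** (the first step of the Hodge filtration of the end-state universe's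
Hodge structure on `ℂ ⊗_ℚ H¹(P_K; ℚ)`), whenever the admissible records at `μ` have their eigencharacter IN their CM type.
[cite: VoisinHodgeI2002, §7.1.1 Def. 7.4 and §7.3.2] -/
theorem cmClasses_subset_hodge_F_one (K : Level V) (μ : T.Char)
    (hadm : ∀ d : LiuCMSide, T.adm μ d → d.τ ∈ d.ΦA.1) :
    T.cmClasses K μ ⊆ ((picardCMUniverse hHD hI h₁ h₃).hodge ((picardCMUniverse hHD hI h₁ h₃).pms L ι₁ V K) 1).F 1 := by
  intro x hx
  rw [hodge_pms_eq]
  exact (Literature.AlgebraicGeometry.HodgeTheory.BettiUniverse.mem_hodge_F_one_iff hHD hI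
    (isSmoothProjective_pms (h₁ := h₁) K) x).2 (isOfHodgeType_one_zero_of_mem_cmClasses T K μ hadm hx)

/-- **T1, span form: `span_ℂ (T.cmClasses K μ) ≤ F¹ H¹(P_K; ℂ)`** — the target of r8's «`res K x ∈ span (cmClasses K μ)`» lies in
the holomorphic step of the Hodge filtration. [cite: VoisinHodgeI2002, §7.1.1 Def. 7.4 and §7.3.2] -/
theorem span_cmClasses_le_hodge_F_one (K : Level V) (μ : T.Char)
    (hadm : ∀ d : LiuCMSide, T.adm μ d → d.τ ∈ d.ΦA.1) :
    Submodule.span ℂ (T.cmClasses K μ) ≤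
      ((picardCMUniverse hHD hI h₁ h₃).hodge ((picardCMUniverse hHD hI h₁ h₃).pms L ι₁ V K) 1).F 1 :=
  Submodule.span_le.2 (cmClasses_subset_hodge_F_one T K μ hadm)

/-- **T1, `(1,0)`-piece form: `T.cmClasses K μ ⊆ H^{1,0}(P_K)`** (the `(1,0)`-piece `F¹ ∩ conj F⁰`-component of the universe's Hodge
structure), under the same hypothesis. [cite: VoisinHodgeI2002, §7.1.1 Def. 7.4] -/
theorem cmClasses_subset_hodge_piece_one_zero (K : Level V) (μ : T.Char)
    (hadm : ∀ d : LiuCMSide, T.adm μ d → d.τ ∈ d.ΦA.1) :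
    T.cmClasses K μ ⊆
      ((picardCMUniverse hHD hI h₁ h₃).hodge ((picardCMUniverse hHD hI h₁ h₃).pms L ι₁ V K) 1).piece ((1 : ℕ) : ℤ) ((0 : ℕ) : ℤ) := by
  intro x hx
  rw [hodge_pms_eq]
  exact (Literature.AlgebraicGeometry.HodgeTheory.BettiUniverse.mem_hodge_piece_iff hHD hI
    (isSmoothProjective_pms (h₁ := h₁) K) (k := 1) (p := 1) (q := 0) rfl x).2
    (isOfHodgeType_one_zero_of_mem_cmClasses T K μ hadm hx)

/-- **Conjugate reading, `(0,1)`-piece form: `T.cmClasses K μ ⊆ H^{0,1}(P_K)`** whenever the admissible records at `μ` have their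
eigencharacter OUTSIDE their CM type. [cite: VoisinHodgeI2002, §7.1.1 Def. 7.4] -/
theorem cmClasses_subset_hodge_piece_zero_one (K : Level V) (μ : T.Char)
    (hadm : ∀ d : LiuCMSide, T.adm μ d → d.τ ∉ d.ΦA.1) :
    T.cmClasses K μ ⊆
      ((picardCMUniverse hHD hI h₁ h₃).hodge ((picardCMUniverse hHD hI h₁ h₃).pms L ι₁ V K) 1).piece ((0 : ℕ) : ℤ) ((1 : ℕ) : ℤ) := by
  intro x hx
  rw [hodge_pms_eq]
  exact (Literature.AlgebraicGeometry.HodgeTheory.BettiUniverse.mem_hodge_piece_iff hHD hI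
    (isSmoothProjective_pms (h₁ := h₁) K) (k := 1) (p := 0) (q := 1) rfl x).2
    (isOfHodgeType_zero_one_of_mem_cmClasses T K μ hadm hx)

end Dictionary

/-! ## §4 At a reflex-keyed dictionary and AT THE LITERAL PIN `liuDictionaryPin … V I line` -/

section Orientation

variable {L : CMField} (ι₁ : (L : Type) →+* ℂ)

open scoped Pointwise
open Literature.NumberTheory.ComplexMultiplication  -- scoped `algEquivCompAction` (σ • φ = σ ∘ φ) + `mem_reflexLift`
open HodgeCM.Model.LiuCMSide (autImage reflexFieldOf reflexTypeC autSet)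

/-- `1 ∈ autSet ι₁ Φ ↔ ι₁ ∈ Φ` (orientation step, after own-crow's `OrientationReflexConj`). [folklore] -/
private theorem one_mem_autSet_iff' (Φ : CMType (L : Type)) : (1 : (L : Type) ≃ₐ[ℚ] (L : Type)) ∈ autSet ι₁ Φ ↔ ι₁ ∈ Φ.1 := by
  change ι₁.comp (1 : (L : Type) ≃ₐ[ℚ] (L : Type)).toRingEquiv.toRingHom ∈ Φ.1 ↔ ι₁ ∈ Φ.1
  exact Iff.of_eq (congrArg (fun χ => χ ∈ Φ.1) (RingHom.ext fun _ => rfl))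

/-- `ι₁ ∘ incl ∈ reflexTypeC ι₁ (autSet ι₁ Φ)` as soon as `ι₁ ∈ Φ` (witness `g = 1`). [cite: Shimura1998, §8.3 Prop. 28] -/
private theorem comp_algebraMap_mem_reflexTypeC' (Φ : CMType (L : Type)) (hι : ι₁ ∈ Φ.1) :
    ι₁.comp (algebraMap (↥(reflexFieldOf (autSet ι₁ Φ))) (L : Type)) ∈ reflexTypeC ι₁ (autSet ι₁ Φ) := by
  refine ⟨1, ?_, RingHom.ext fun _ => rfl⟩
  rw [mem_reflexLift, inv_one, one_smul]
  exact ⟨1, (one_mem_autSet_iff' ι₁ Φ).2 hι, rfl⟩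

/-- **ORIENTATION STEP** (own-crow, ORIENTATION-MEMO §1; reproduced here privately so this file does not depend on the filing order of
`CorCM/D2Bridge/OrientationReflexConj.lean`): a record admissible for `Φ` through `ι₁` with `ι₁ ∈ Φ` has its eigencharacter IN its CM type.
[cite: Shimura1998, §8.3 Prop. 28] [cite: Liu2021, Definition 4.3 (TeX ll. 1914–1921)] -/
private theorem tau_mem_cmType_of_isReflexOfType' (d : LiuCMSide) (Φ : CMType (L : Type)) (h : d.IsReflexOfType ι₁ Φ)
    (hι : ι₁ ∈ Φ.1) : d.τ ∈ d.ΦA.1 := by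
  refine (d.hΦA d.τ).2 ?_
  obtain ⟨ε, h1, h2⟩ := h
  rw [h2, h1]
  have hcomp : ((ι₁.comp (algebraMap (↥(reflexFieldOf (autSet ι₁ Φ))) (L : Type))).comp ε.toRingHom).comp ε.symm.toRingHom =
      ι₁.comp (algebraMap (↥(reflexFieldOf (autSet ι₁ Φ))) (L : Type)) :=
    RingHom.ext fun x => by
      simp only [RingHom.coe_comp, Function.comp_apply, RingEquiv.toRingHom_eq_coe, RingHom.coe_coe, RingEquiv.apply_symm_apply]
  rw [hcomp]
  exact comp_algebraMap_mem_reflexTypeC' ι₁ Φ hι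

variable {hHD : exists_isReal_hodgeModel} {hI : hodgePQ_independent_of_hodgeModel}
  {h₁ : BallQuotientUniformised} {h₃ : CMAbelianVarietyRealised} {hA : Literature.NumberTheory.Transcendental.Arapura2012_Cor_15_4_6}
variable {ι₁} {V : HermSpace3 L ι₁}

/-- **T1 at a REFLEX-KEYED dictionary** (`adm μ d → d.IsReflexOfTypeG ι₁ Φ`, `L/ℚ` Galois, `ι₁ ∈ Φ`): every CM class at `μ` is a
`(1,0)`-class on `P_K`. [cite: VoisinHodgeI2002, §7.3.2] [cite: Shimura1998, §5.2 (pp. 36–37) and §8.3 Prop. 28] -/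
theorem isOfHodgeType_one_zero_of_mem_cmClasses_of_isReflexOfTypeG [IsGalois ℚ (L : Type)]
    (T : LiuDictionary hHD hI h₁ h₃ V) (K : Level V) (μ : T.Char) (Φ : CMType (L : Type))
    (hadm : ∀ d : LiuCMSide, T.adm μ d → d.IsReflexOfTypeG ι₁ Φ) (hι : ι₁ ∈ Φ.1)
    {x : (picardCMUniverse hHD hI h₁ h₃).CohC ((picardCMUniverse hHD hI h₁ h₃).pms L ι₁ V K) 1}
    (hx : x ∈ T.cmClasses K μ) :
    IsOfHodgeType 2 (pmsRealisation (ballQuotientUniformisedDatum_of h₁) (pmsCode L ι₁ V K)).X 1 1 0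
      (ofRatClassBaseChange (ComplexPoints (pmsRealisation (ballQuotientUniformisedDatum_of h₁) (pmsCode L ι₁ V K)).X) 1 x) :=
  isOfHodgeType_one_zero_of_mem_cmClasses T K μ
    (fun d hd => tau_mem_cmType_of_isReflexOfType' ι₁ d Φ (hadm d hd inferInstance) hι) hx

/-- **T1 at a reflex-keyed dictionary, span ∕ filtration form: `span_ℂ (T.cmClasses K μ) ≤ F¹ H¹(P_K; ℂ)`.**
[cite: VoisinHodgeI2002, §7.1.1 Def. 7.4 and §7.3.2] [cite: Shimura1998, §8.3 Prop. 28] -/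
theorem span_cmClasses_le_hodge_F_one_of_isReflexOfTypeG [IsGalois ℚ (L : Type)]
    (T : LiuDictionary hHD hI h₁ h₃ V) (K : Level V) (μ : T.Char) (Φ : CMType (L : Type))
    (hadm : ∀ d : LiuCMSide, T.adm μ d → d.IsReflexOfTypeG ι₁ Φ) (hι : ι₁ ∈ Φ.1) :
    Submodule.span ℂ (T.cmClasses K μ) ≤
      ((picardCMUniverse hHD hI h₁ h₃).hodge ((picardCMUniverse hHD hI h₁ h₃).pms L ι₁ V K) 1).F 1 :=
  span_cmClasses_le_hodge_F_one T K μ (fun d hd => tau_mem_cmType_of_isReflexOfType' ι₁ d Φ (hadm d hd inferInstance) hι)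

variable (V) (I : Type) (line : I → SplitLineE V)

/-- **T1 AT THE LITERAL PIN** `T := liuDictionaryPin hHD hI h₁ h₃ hA V I line` (`adm i d = d.IsReflexOfTypeG ι₁ (typeOfLine (line i))`,
`PhiMu i = (ι₁ ∈ (typeOfLine (line i)).1)`, both by `rfl`), `L/ℚ` Galois: at every index line `i` with `PhiMu i`, EVERY element of
`cmClasses K i` — the generator set the `i`-th clause of `h418 ∕ Thm418C` asks the `K`-fixed vectors of `block i` to restrict into — is a
class of Hodge type `(1,0)` on `P_K`. [cite: VoisinHodgeI2002, §7.3.2] [cite: Shimura1998, §5.2 (pp. 36–37) and §8.3 Prop. 28] -/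
theorem isOfHodgeType_one_zero_of_mem_cmClasses_pin [IsGalois ℚ (L : Type)] (K : Level V) (i : I)
    (hμ : (liuDictionaryPin hHD hI h₁ h₃ hA V I line).PhiMu i)
    {x : (picardCMUniverse hHD hI h₁ h₃).CohC ((picardCMUniverse hHD hI h₁ h₃).pms L ι₁ V K) 1}
    (hx : x ∈ (liuDictionaryPin hHD hI h₁ h₃ hA V I line).cmClasses K i) :
    IsOfHodgeType 2 (pmsRealisation (ballQuotientUniformisedDatum_of h₁) (pmsCode L ι₁ V K)).X 1 1 0
      (ofRatClassBaseChange (ComplexPoints (pmsRealisation (ballQuotientUniformisedDatum_of h₁) (pmsCode L ι₁ V K)).X) 1 x) :=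
  isOfHodgeType_one_zero_of_mem_cmClasses_of_isReflexOfTypeG (liuDictionaryPin hHD hI h₁ h₃ hA V I line) K i
    (SplitLine.typeOfLine (line i)) (fun _ hd => hd) hμ hx

/-- **T1 AT THE LITERAL PIN, span ∕ filtration form: `span_ℂ (cmClasses K i) ≤ F¹ H¹(P_K; ℂ)` at every `PhiMu` line.**
[cite: VoisinHodgeI2002, §7.1.1 Def. 7.4 and §7.3.2] [cite: Shimura1998, §8.3 Prop. 28] -/
theorem span_cmClasses_le_hodge_F_one_pin [IsGalois ℚ (L : Type)] (K : Level V) (i : I)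
    (hμ : (liuDictionaryPin hHD hI h₁ h₃ hA V I line).PhiMu i) :
    Submodule.span ℂ ((liuDictionaryPin hHD hI h₁ h₃ hA V I line).cmClasses K i) ≤
      ((picardCMUniverse hHD hI h₁ h₃).hodge ((picardCMUniverse hHD hI h₁ h₃).pms L ι₁ V K) 1).F 1 :=
  span_cmClasses_le_hodge_F_one_of_isReflexOfTypeG (liuDictionaryPin hHD hI h₁ h₃ hA V I line) K i
    (SplitLine.typeOfLine (line i)) (fun _ hd => hd) hμ

/-- **T1 AT THE LITERAL PIN, `(1,0)`-piece form: `cmClasses K i ⊆ H^{1,0}(P_K)` at every `PhiMu` line.**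
[cite: VoisinHodgeI2002, §7.1.1 Def. 7.4] [cite: Shimura1998, §8.3 Prop. 28] -/
theorem cmClasses_subset_hodge_piece_one_zero_pin [IsGalois ℚ (L : Type)] (K : Level V) (i : I)
    (hμ : (liuDictionaryPin hHD hI h₁ h₃ hA V I line).PhiMu i) :
    (liuDictionaryPin hHD hI h₁ h₃ hA V I line).cmClasses K i ⊆
      ((picardCMUniverse hHD hI h₁ h₃).hodge ((picardCMUniverse hHD hI h₁ h₃).pms L ι₁ V K) 1).piece ((1 : ℕ) : ℤ) ((0 : ℕ) : ℤ) :=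
  cmClasses_subset_hodge_piece_one_zero (liuDictionaryPin hHD hI h₁ h₃ hA V I line) K i
    (fun d hd => tau_mem_cmType_of_isReflexOfType' ι₁ d (SplitLine.typeOfLine (line i)) (hd inferInstance) hμ)

end Orientation

end Summit.HodgeConjecture.CorCM.D2Bridge

end
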